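import Literature.MathematicalPhysics.QuantumLattice.HardCoreBosonRepulsionInfiniteVolumeGroundStates
import HarnessLib

/-!
# The spin-½ XXZ models on the SQUARE LATTICE `ℤ²` in the tree's certified planar window: infinite-volume
# ground states with planar (Néel / uniform) order, and non-uniqueness — the `(d, S) = (2, ½)` leg of
# Koma–Tasaki's infinitesimal-field ground states

Topic `MathematicalPhysics/QuantumLattice`; family `hubbard` (cell `hubbard-cq`, transfer source «hard-core boson / XXZ»).
The tree's infinite-volume statements for quantum spins — `XXZAntiferromagnetInfiniteVolumeOrder.lean` (the
infinitesimal-field ground states `ω̃ = lim_{B↓0} lim_{Λ↑ℤ^d} ω_{GS, H_Λ - BO_Λ}` of Koma–Tasaki 1993 (1.8) along even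
tori, `XXZKT.IsInfinitesimalFieldGroundState`, and the engine `XXZKT.le_stagMagnetisation_ground_of_eventually`: a
finite-volume floor `N⁻¹Re ω_{GS,B}(O_Λ) ≥ m - ε` eventually, for every `B > 0`, `ε > 0`, passes to
`(-1)^x Re ω(Sˣ_x) ≥ m` at every site), `XXZInfiniteVolumeEquilibriumStates.lean` (these states ARE infinite-volume
ground states, `IsInfinitesimalFieldGroundState.isGroundState_xxz`; non-uniqueness `xxzAF_groundState_not_unique`) and
`HardCoreBosonRepulsionInfiniteVolumeGroundStates.lean` (the sublattice half-turn carrying the antiferromagnet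
`(J, Δ)` to the planar ferromagnet / hard-core Bose gas `(-J, -Δ)`) — all EXCLUDE `(d, S) = (2, ½)`, because their
finite-volume input `xxzAF_ground_spontaneousStaggeredMagnetisation` does ("WHAT THIS IS NOT: `d = 2`, `S = ½` is
excluded (as in the antiferromagnetic input)").  But the tree DOES prove ground-state planar long-range order for the
spin-½ XXZ antiferromagnet on `ℤ²` in the certified window `0 ≤ Δ ≤ 0.15` (`xxzAF_ground_planar_spinHalf_x`,
Kennedy–Lieb–Shastry 1988 / Kubo–Kishi 1988 with the tree's certified two-dimensional Gaussian-domination constants),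
and Koma–Tasaki's Theorem 7.3 for it (`XXZKT.xxzAF_ground_spontaneousStaggeredMagnetisation_spinHalf_two`,
`XXZGroundStateSpontaneousOrder.lean`).  This file runs the same infinite-volume machinery on that input.

Koma–Tasaki, Commun. Math. Phys. **158** (1993) 191–214, §1 (1.8)–(1.10) and §7 Theorem 7.3 (7.11) (the `U(1)` case,
factor `√2`); J. Stat. Phys. **76** (1994) 745–803, §3.3 (hard-core Bose gas, (3.22) `ω_θ(a_x) ≥ √2 o μ`, "the states
`ω_θ` are really infinite volume ground states"); Kennedy–Lieb–Shastry, Phys. Rev. Lett. **61** (1988) 2582 (the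
two-dimensional spin-½ XY model has ground-state LRO) and J. Stat. Phys. **53** (1988) 1019 (small `Δ`).

## What this file proves (0 definitions, 0 named facts, 0 sorry) — all for `d = 2`, `S = ½` (`n = 1`)

* §1 `xxzAF_ground_spontaneousStaggeredMagnetisation_spinHalf_two_groundStateFunctional` — the tracial finite-volume
  form (uniform mixture of the ground states of `H - B·O_Λ`) of the tree's Theorem 7.3 for the spin-½ XXZ
  antiferromagnet on `(ℤ/(2k+2)ℤ)²`, `J > 0`, `0 ≤ Δ ≤ 0.15`.
* §2 **`xxzAF_infiniteVolume_groundState_spontaneousStaggeredMagnetisation_spinHalf_two`**: `∃ σ > 0` with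
  `(-1)^x Re ω(Sˣ_x) ≥ √2σ` at every site, for every sourced ground-state limit state (`B > 0`) and every
  infinitesimal-field ground state of the spin-½ XXZ antiferromagnet on `ℤ²`, `0 ≤ Δ ≤ 0.15`;
  **`xxzAF_spinHalf_two_exists_groundState_planarOrder`**: an infinite-volume ground state
  (`∈ groundStates (xxzLatticeInteraction 2 1 J Δ) 1`, Bratteli–Robinson's local criterion), invariant under the even
  translations, with the same planar Néel order at every site; `xxzAF_spinHalf_two_groundState_not_unique`,
  `xxzAF_spinHalf_two_not_hasUniqueGroundState`: at least two infinite-volume ground states, the ordered one breaking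
  the unit translations.
* §3 the planar FERROMAGNET / hard-core Bose gas on `ℤ²` (sublattice half-turn): `J < 0`, `-0.15 ≤ Δ ≤ 0`:
  **`xxzPlanarFerro_spinHalf_two_exists_groundState_planarMagnetisation`** (`Re ω(Sˣ_x) ≥ √2σ` at every site —
  explicit `U(1)` breaking), `xxzPlanarFerro_spinHalf_two_not_hasUniqueGroundState`; in boson language
  (`J = -2t`, `Δ = -V/2t`: hopping `t > 0`, nearest-neighbour repulsion `0 ≤ V ≤ 0.3t`, particle–hole symmetric
  chemical potential) **`hardCoreBoson_two_exists_groundState_condensate`**: an infinite-volume ground state of the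
  TWO-DIMENSIONAL hard-core Bose gas with `Re ω(½(a_x + a†_x)) = Re ω(Sˣ_x) ≥ c > 0` at every site — Bose–Einstein
  condensation with a non-zero condensate wave function in the ground state on `ℤ²` (where there is none at `T > 0`) —
  and `hardCoreBoson_two_not_hasUniqueGroundState`.

WHAT THIS IS NOT: nothing outside the certified windows (`|Δ| ≤ 0.15`; the isotropic square-lattice spin-½ Heisenberg
antiferromagnet is not covered — its ground-state Néel order is open); no positive-temperature statement (there is no
order at `T > 0` in `d = 2`); no statement about the staggered-field gas `λ ≠ 0` (its infinite-volume formulation needs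
its own lattice interaction); nothing about the Hubbard model.

## References
* [KomaTasaki1993] T. Koma, H. Tasaki, Commun. Math. Phys. **158** (1993) 191–214, §1 (1.8)–(1.10), §7 Thm. 7.3.
* [KomaTasaki1994] T. Koma, H. Tasaki, J. Stat. Phys. **76** (1994) 745–803, §3.3, eq. (3.22).
* [KLS1988PRL] T. Kennedy, E. H. Lieb, B. S. Shastry, Phys. Rev. Lett. **61** (1988) 2582–2584.
* [KennedyLiebShastryJSP1988] T. Kennedy, E. H. Lieb, B. S. Shastry, J. Stat. Phys. **53** (1988) 1019–1030.
* [KuboKishi1988] K. Kubo, T. Kishi, Phys. Rev. Lett. **61** (1988) 2585.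
* [BratteliRobinsonII1997] O. Bratteli, D. W. Robinson, *Operator Algebras and Quantum Statistical Mechanics 2*,
  Def. 5.3.18, §6.2.7.
* [MatsubaraMatsuda1956] T. Matsubara, H. Matsuda, Prog. Theor. Phys. **16** (1956) 569–582, §2.
-/

noncomputable section

open Filter Topology Matrix Complex Finset
open Literature.MathematicalPhysics.QuantumLattice Literature.MathematicalPhysics.QuantumLattice.SpinOperators
  Literature.Probability.LatticeModels
open scoped ComplexOrder

namespace Literature.MathematicalPhysics.QuantumLattice

namespace XXZKT

/-! ### §1 The tracial finite-volume form on `(ℤ/(2k+2)ℤ)²` -/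

/-- **Spin-½ XXZ antiferromagnet on `ℤ²`, `0 ≤ Δ ≤ 0.15`, tracial form**: for every `B > 0`, `ε > 0`, eventually on
the even tori `(ℤ/(2k+2)ℤ)²` the uniform mixture `ω_{GS,B}` of the ground states of `H - B·O_Λ` (`O_Λ = Σ_x(-1)^xSˣ_x`)
has `N⁻¹Re ω_{GS,B}(O_Λ) ≥ √2σ - ε`. [cite: KomaTasaki1993, Theorem 7.3 (7.11), §1 (1.9)] [cite: KLS1988PRL, Theorem] -/
theorem xxzAF_ground_spontaneousStaggeredMagnetisation_spinHalf_two_groundStateFunctional {J : ℝ} (hJ : 0 < J)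
    {Δ : ℝ} (hΔ : 0 ≤ Δ) (hΔ' : Δ ≤ 0.15) :
    ∃ σ : ℝ, 0 < σ ∧ ∀ B : ℝ, 0 < B → ∀ ε : ℝ, 0 < ε → ∀ᶠ k : ℕ in atTop,
      Real.sqrt 2 * σ - ε ≤
        ((xxzHamiltonian 1 (torusGraph 2 (2 * k + 2)) J Δ -
              (B : ℂ) • stagSpin 1 (torusParityExp 2 (2 * k + 2)) 0).groundStateFunctional
            (stagSpin 1 (torusParityExp 2 (2 * k + 2)) 0)).re /
          (Fintype.card (TorusSite 2 (2 * k + 2)) : ℝ) := by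
  obtain ⟨σ, hσ, h⟩ := xxzAF_ground_spontaneousStaggeredMagnetisation_spinHalf_two hJ hΔ hΔ'
  refine ⟨σ, hσ, fun B hB ε hε => (h B hB ε hε).mono fun k hk => ?_⟩
  have hHB : (xxzHamiltonian 1 (torusGraph 2 (2 * k + 2)) J Δ -
      (B : ℂ) • stagSpin 1 (torusParityExp 2 (2 * k + 2)) 0).IsHermitian :=
    (xxzHamiltonian_isHermitian 1 _ J Δ).sub ((isHermitian_stagSpin 1 _ 0).smul
      (by rw [isSelfAdjoint_iff, Complex.star_def, Complex.conj_ofReal]))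
  exact le_re_groundStateFunctional_div_of_forall_groundState hHB _ (Nat.cast_nonneg _) hk

/-! ### §2 The spin-½ XXZ antiferromagnet on `ℤ²`: infinite-volume ground states with planar Néel order -/

/-- **SPIN-½ XXZ ANTIFERROMAGNET ON `ℤ²`, `0 ≤ Δ ≤ 0.15`, GROUND STATES, IN INFINITE VOLUME**: there is `σ > 0` with
`√2σ ≤ (-1)^x Re ω(Sˣ_x)` at every site for every sourced ground-state limit state (`B > 0`) and every infinitesimal-field
ground state. [cite: KomaTasaki1993, §7 Thm. 7.3, §1 (1.8)–(1.10)] [cite: KLS1988PRL, Theorem] [cite: KuboKishi1988] -/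
theorem xxzAF_infiniteVolume_groundState_spontaneousStaggeredMagnetisation_spinHalf_two {J : ℝ} (hJ : 0 < J)
    {Δ : ℝ} (hΔ : 0 ≤ Δ) (hΔ' : Δ ≤ 0.15) :
    ∃ σ : ℝ, 0 < σ ∧
      (∀ B : ℝ, 0 < B → ∀ ω : InfVolState 2 (1 + 1), IsSourcedGroundStateLimit 2 1 J Δ 0 B ω →
          ∀ x : Site 2, Real.sqrt 2 * σ ≤ latticeStagger x * (ω.expect {x} (siteSpinAt 1 x 0)).re) ∧
        ∀ ω : InfVolState 2 (1 + 1), IsInfinitesimalFieldGroundState 2 1 J Δ 0 ω →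
          ∀ x : Site 2, Real.sqrt 2 * σ ≤ latticeStagger x * (ω.expect {x} (siteSpinAt 1 x 0)).re := by
  obtain ⟨σ, hσ, H⟩ := xxzAF_ground_spontaneousStaggeredMagnetisation_spinHalf_two_groundStateFunctional hJ hΔ hΔ'
  refine ⟨σ, hσ, le_stagMagnetisation_ground_of_eventually fun B hB ε hε => (H B hB ε hε).mono fun k hk => ?_⟩
  rwa [div_eq_inv_mul] at hk

/-- **AN INFINITE-VOLUME GROUND STATE OF THE SPIN-½ XXZ ANTIFERROMAGNET ON THE SQUARE LATTICE WITH PLANAR NÉEL ORDER**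
(`J > 0`, `0 ≤ Δ ≤ 0.15`): there are `σ > 0` and `ω ∈ groundStates (xxzLatticeInteraction 2 1 J Δ) 1` (Bratteli–Robinson's
local criterion), invariant under the even translations of `ℤ²`, with the same staggered planar magnetisation
`(-1)^x Re ω(Sˣ_x) ≥ √2σ` at every site — Koma–Tasaki's infinitesimal-field ground state (1.8).
[cite: KomaTasaki1993, §7 Thm. 7.3, §1 (1.8)] [cite: KLS1988PRL, Theorem] [cite: BratteliRobinsonII1997, Def. 5.3.18] -/
theorem xxzAF_spinHalf_two_exists_groundState_planarOrder {J : ℝ} (hJ : 0 < J) {Δ : ℝ} (hΔ : 0 ≤ Δ) (hΔ' : Δ ≤ 0.15) :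
    ∃ σ : ℝ, 0 < σ ∧ ∃ ω : InfVolState 2 (1 + 1),
      ω ∈ groundStates (xxzLatticeInteraction 2 1 J Δ) 1 ∧
      (∀ v : Site 2, latticeStagger v = 1 → ω.shift v = ω) ∧
      (∀ x y : Site 2, latticeStagger x * (ω.expect {x} (siteSpinAt 1 x 0)).re =
        latticeStagger y * (ω.expect {y} (siteSpinAt 1 y 0)).re) ∧
      ∀ x : Site 2, Real.sqrt 2 * σ ≤ latticeStagger x * (ω.expect {x} (siteSpinAt 1 x 0)).re := by
  obtain ⟨σ, hσ, -, hfloor⟩ :=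
    xxzAF_infiniteVolume_groundState_spontaneousStaggeredMagnetisation_spinHalf_two hJ hΔ hΔ'
  obtain ⟨ω, hω⟩ := exists_isInfinitesimalFieldGroundState (d := 2) (n := 1) J Δ 0
  obtain ⟨hshift, hconst⟩ := hω.shift_eq_and_stagMagnetisation_eq
  exact ⟨σ, hσ, ω, hω.isGroundState_xxz, hshift, hconst, hfloor ω hω⟩

/-- **THE SPIN-½ XXZ ANTIFERROMAGNET ON `ℤ²` (`0 ≤ Δ ≤ 0.15`) DOES NOT HAVE A UNIQUE INFINITE-VOLUME GROUND STATE**: the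
`x`-sourced infinitesimal-field ground state (planar Néel order) and the `y`-sourced one (`ω(Sˣ_x) = 0`) are distinct
ground states, and the ordered one breaks the unit translations. [cite: KomaTasaki1993, §7 Thm. 7.3, §1 (1.8)]
[cite: KLS1988PRL, Theorem] [cite: BratteliRobinsonII1997, §6.2.7] -/
theorem xxzAF_spinHalf_two_groundState_not_unique {J : ℝ} (hJ : 0 < J) {Δ : ℝ} (hΔ : 0 ≤ Δ) (hΔ' : Δ ≤ 0.15) :
    ∃ ω₀ ω₁ : InfVolState 2 (1 + 1),
      ω₀ ∈ groundStates (xxzLatticeInteraction 2 1 J Δ) 1 ∧ ω₁ ∈ groundStates (xxzLatticeInteraction 2 1 J Δ) 1 ∧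
      ω₀ ≠ ω₁ ∧ ∀ i : Fin 2, ω₀.shift (unitVec i) ∈ groundStates (xxzLatticeInteraction 2 1 J Δ) 1 ∧
        ω₀.shift (unitVec i) ≠ ω₀ := by
  have hΦ := isTranslationInvariant_xxzLatticeInteraction (d := 2) 1 J Δ
  obtain ⟨σ, hσ, -, hfloor⟩ :=
    xxzAF_infiniteVolume_groundState_spontaneousStaggeredMagnetisation_spinHalf_two hJ hΔ hΔ'
  obtain ⟨ω₀, hω₀⟩ := exists_isInfinitesimalFieldGroundState (d := 2) (n := 1) J Δ 0
  obtain ⟨ω₁, hω₁⟩ := exists_isInfinitesimalFieldGroundState (d := 2) (n := 1) J Δ 1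
  have h2 : (0 : ℝ) < Real.sqrt 2 * σ := mul_pos (Real.sqrt_pos.2 (by norm_num)) hσ
  refine ⟨ω₀, ω₁, hω₀.isGroundState_xxz, hω₁.isGroundState_xxz, fun heq => ?_, fun i =>
    ⟨shift_mem_groundStates hω₀.isGroundState_xxz hΦ _, fun heq => ?_⟩⟩
  · have h0 := hfloor ω₀ hω₀ 0
    rw [heq, hω₁.expect_siteSpinAt_zero_eq_zero 0, Complex.zero_re, mul_zero] at h0
    linarith
  · have h1 := hfloor ω₀ hω₀ 0
    have h3 := hfloor ω₀ hω₀ ((0 : Site 2) + unitVec i)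
    rw [latticeStagger_add_unitVec, ← InfVolState.shift_expect_siteSpinAt ω₀ (unitVec i) 0 0, heq, neg_mul] at h3
    linarith

/-- In particular `¬ HasUniqueGroundState (xxzLatticeInteraction 2 1 J Δ) 1` for `J > 0`, `0 ≤ Δ ≤ 0.15`.
[cite: KomaTasaki1993, §7 Thm. 7.3] [cite: KLS1988PRL, Theorem] -/
theorem xxzAF_spinHalf_two_not_hasUniqueGroundState {J : ℝ} (hJ : 0 < J) {Δ : ℝ} (hΔ : 0 ≤ Δ) (hΔ' : Δ ≤ 0.15) :
    ¬ HasUniqueGroundState (xxzLatticeInteraction 2 1 J Δ) 1 := by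
  rintro ⟨ω, -, huniq⟩
  obtain ⟨ω₀, ω₁, h₀, h₁, hne, -⟩ := xxzAF_spinHalf_two_groundState_not_unique hJ hΔ hΔ'
  exact hne ((huniq ω₀ h₀).trans (huniq ω₁ h₁).symm)

/-! ### §3 The planar ferromagnet / the hard-core Bose gas on `ℤ²` -/

/-- **A GROUND STATE OF THE SPIN-½ PLANAR-FERROMAGNETIC XXZ MODEL ON `ℤ²` WITH UNIFORM PLANAR MAGNETISATION**
(`J < 0`, `-0.15 ≤ Δ ≤ 0`): there are `σ > 0` and an infinite-volume ground state `ω` of `xxzLatticeInteraction 2 1 J Δ`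
with `Re ω(Sˣ_x) ≥ √2σ` AT EVERY SITE — explicit `U(1)` breaking; the sublattice half-turn of §2's state for the
antiferromagnet `(-J, -Δ)`. [cite: KomaTasaki1994, §3.3 eq. (3.22)] [cite: KomaTasaki1993, §7 Thm. 7.3] [cite: KLS1988PRL, Theorem] -/
theorem xxzPlanarFerro_spinHalf_two_exists_groundState_planarMagnetisation {J : ℝ} (hJ : J < 0) {Δ : ℝ}
    (hΔ0 : Δ ≤ 0) (hΔ1 : -0.15 ≤ Δ) :
    ∃ σ : ℝ, 0 < σ ∧ ∃ ω : InfVolState 2 (1 + 1), ω ∈ groundStates (xxzLatticeInteraction 2 1 J Δ) 1 ∧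
      ∀ x : Site 2, Real.sqrt 2 * σ ≤ (ω.expect {x} (siteSpinAt 1 x 0)).re := by
  obtain ⟨σ, hσ, -, hfloor⟩ := xxzAF_infiniteVolume_groundState_spontaneousStaggeredMagnetisation_spinHalf_two
    (neg_pos.2 hJ) (neg_nonneg.2 hΔ0) (by linarith : -Δ ≤ 0.15)
  obtain ⟨ω₀, hω₀⟩ := exists_isInfinitesimalFieldGroundState (d := 2) (n := 1) (-J) (-Δ) 0
  obtain ⟨ω, hω⟩ := ω₀.exists_twist (fun z : Site 2 => Real.pi * ((1 - latticeStagger z) / 2))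
  have hgs : ω.IsGroundState (xxzLatticeInteraction 2 1 J Δ) 1 :=
    InfVolState.IsGroundState.of_expect_eq_twist (fun z : Site 2 => Real.pi * ((1 - latticeStagger z) / 2))
      (xxzLatticeInteraction_neg_neg_eq_twist_conj (d := 2) 1 J Δ) hω₀.isGroundState_xxz hω
  refine ⟨σ, hσ, ω, hgs, fun x => ?_⟩
  have h := hfloor ω₀ hω₀ x
  rw [hω, siteSpinAt, sublatticeTwist_conj_siteSpin, if_neg (by decide), map_smul, smul_eq_mul,
    Complex.re_ofReal_mul]
  exact h

/-- **The spin-½ planar ferromagnet on `ℤ²` (`J < 0`, `-0.15 ≤ Δ ≤ 0`) does not have a unique infinite-volume ground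
state.** [cite: KomaTasaki1994, §3.3] [cite: KomaTasaki1993, §7 Thm. 7.3] -/
theorem xxzPlanarFerro_spinHalf_two_not_hasUniqueGroundState {J : ℝ} (hJ : J < 0) {Δ : ℝ} (hΔ0 : Δ ≤ 0)
    (hΔ1 : -0.15 ≤ Δ) : ¬ HasUniqueGroundState (xxzLatticeInteraction 2 1 J Δ) 1 := by
  rw [← neg_neg J, ← neg_neg Δ, hasUniqueGroundState_xxz_neg_neg_iff]
  exact xxzAF_spinHalf_two_not_hasUniqueGroundState (neg_pos.2 hJ) (neg_nonneg.2 hΔ0) (by linarith)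

/-- **BOSE–EINSTEIN CONDENSATION WITH EXPLICIT `U(1)` BREAKING IN AN INFINITE-VOLUME GROUND STATE OF THE
TWO-DIMENSIONAL HARD-CORE BOSE GAS** (hopping `t > 0`, nearest-neighbour repulsion `0 ≤ V ≤ 0.3t`, particle–hole
symmetric chemical potential): there are `c > 0` and an infinite-volume ground state `ω` of
`xxzLatticeInteraction 2 1 (-2t) (-V/2t)` (the Bose gas on `ℤ²`, Matsubara–Matsuda; `HardCoreBoson.hamiltonianNN_eq_xxzHamiltonian`)
with `Re ω(½(a_x + a†_x)) = Re ω(Sˣ_x) ≥ c` at every site `x` — Koma–Tasaki's `ω_{θ=0}(a_x) ≥ √2 o μ` ((3.22)), here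
on the square lattice, in the GROUND STATE (at `T > 0` there is no condensate in two dimensions).
[cite: KomaTasaki1994, §3.3 eq. (3.22)] [cite: KLS1988PRL, Theorem] [cite: MatsubaraMatsuda1956, §2] -/
theorem hardCoreBoson_two_exists_groundState_condensate {t V : ℝ} (ht : 0 < t) (hV0 : 0 ≤ V) (hV1 : V ≤ 0.3 * t) :
    ∃ c : ℝ, 0 < c ∧ ∃ ω : InfVolState 2 2,
      ω ∈ groundStates (xxzLatticeInteraction 2 1 (-(2 * t)) (-(V / (2 * t)))) 1 ∧
        ∀ x : Site 2, c ≤ (ω.expect {x} (siteSpinAt 1 x 0)).re := by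
  have hΔ1 : -0.15 ≤ -(V / (2 * t)) := by
    rw [neg_le_neg_iff, div_le_iff₀ (by positivity)]
    linarith
  obtain ⟨σ, hσ, ω, hω, h⟩ := xxzPlanarFerro_spinHalf_two_exists_groundState_planarMagnetisation
    (J := -(2 * t)) (Δ := -(V / (2 * t))) (by linarith) (by rw [neg_nonpos]; positivity) hΔ1
  exact ⟨Real.sqrt 2 * σ, mul_pos (Real.sqrt_pos.2 (by norm_num)) hσ, ω, hω, h⟩

/-- **THE TWO-DIMENSIONAL HARD-CORE BOSE GAS WITH WEAK NEAREST-NEIGHBOUR REPULSION HAS AT LEAST TWO INFINITE-VOLUME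
GROUND STATES** (`t > 0`, `0 ≤ V ≤ 0.3t`): obscured `U(1)` breaking as non-uniqueness. [cite: KomaTasaki1994, §3.3]
[cite: KLS1988PRL, Theorem] [cite: MatsubaraMatsuda1956, §2] -/
theorem hardCoreBoson_two_not_hasUniqueGroundState {t V : ℝ} (ht : 0 < t) (hV0 : 0 ≤ V) (hV1 : V ≤ 0.3 * t) :
    ¬ HasUniqueGroundState (xxzLatticeInteraction 2 1 (-(2 * t)) (-(V / (2 * t)))) 1 := by
  have hΔ1 : -0.15 ≤ -(V / (2 * t)) := by
    rw [neg_le_neg_iff, div_le_iff₀ (by positivity)]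
    linarith
  exact xxzPlanarFerro_spinHalf_two_not_hasUniqueGroundState (by linarith) (by rw [neg_nonpos]; positivity) hΔ1

end XXZKT

end Literature.MathematicalPhysics.QuantumLattice
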